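import Mathlib
import HarnessLib
import Summits.AtomisticToContinuum.FouriersLaw.Theses.JunctionLocality
import Summits.AtomisticToContinuum.FouriersLaw.Theorems.JunctionLocalitySuperadditiveResistanceStubProbeRemovalCostAux2

/-!
# Probe-removal cost in the κ-frame, helper III: the MASTER PAIRING and the four κ-frame PROBE-REMOVAL IDENTITIES
# in Dirichlet (junction-gradient) form
(helper `--supports` stmt-AtomisticToContinuum-11748 for stub `stub_probeRemovalCost` (S3') of line
`floating-probe-bypass-laplacian`, skeleton v7/v8, crux `JunctionLocality.SuperadditiveResistance`)

Notation: `L = N + M`, `μ_T` the Gibbs state of the `L`-chain, `R` the momentum reversal, `S` the site reflection,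
`K(κ)` the resolvent Kubo matrix of a family `g a ∈ deviceResolventFields … (termSite N M a) κ`, `G_L = plainKubo … gL` for a
plain forward field `gL ∈ plainForwardFields … L` of the WHOLE chain, `gR := gL ∘ S` the right bath's forward field
(landed `generator_comp_siteReflection_left`), `c = γ²/T²`, and
`Π(h, g) := κ⟨h∘R, g⟩ + γT(⟨∂_{p_{N−1}}(h∘R), ∂_{p_{N−1}} g⟩ + ⟨∂_{p_N}(h∘R), ∂_{p_N} g⟩)` (pairings in `L²(μ_T)`).
Helper I wrote `K₀₀ − G_L` with the probe-pair OU operator under the SECOND-order hypothesis `S_K(g 0) ∈ L²`; here the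
FIRST-order form, for all four Schur-variable differences, under the junction-gradient regularity of the PLAIN field only
(explicit hypotheses `∂_{p_{N−1}} gL, ∂_{p_N} gL ∈ L²(μ_T)`, resp. the mirrored `∂_{p_{M−1}} gL, ∂_{p_M} gL` for `gR`: the probes
sit at INTERIOR sites of the plain chain, where `Kubo.memLp_partialP` gives nothing — the obstacle named by the line lead;
the DEVICE field's probe gradients are in `L²` for free because the probes are thermostats of the device):

* `tendsto_plainPair_resolvent_pairing` (NO regularity hypothesis) and `plainPair_resolvent_pairing` — for a plain pair
  `L^{T,T} h = −(kin t − T)` and a device resolvent field `κ g − L_dev g = kin s − T`: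
  `⟨h, kin s − T⟩ − ⟨g, kin t − T⟩ = Π(h, g)` (helper II's `cross_addWeights` for `g` against `h∘R`, reversal invariance);
* (I0)  `kuboMatrix_zero_zero_sub_plainKubo_dirichlet`   `K₀₀ − G_L = c·Π(gL, g 0)`;
* (I3)  `plainKubo_add_kuboMatrix_three_zero_dirichlet`  `G_L + K₃₀ = c·Π(gL, g 3)` (far-end sum rule `plainField_endPairing`);
* (I3') `kuboMatrix_three_three_sub_plainKubo_dirichlet` `K₃₃ − G_L = c·Π(gR, g 3)` (`S`-invariance of `μ_T`);
* (I0') `plainKubo_add_kuboMatrix_zero_three_dirichlet`  `G_L + K₀₃ = c·Π(gR, g 0)`.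

So `a − G_L`, `b − G_L` and `G_L − x` (`= G_L + K₀₃ = G_L + K₃₀` by Onsager symmetry) are JUNCTION-LOCALISED pairings, and
`G_L(a+b−2x) − (ab−x²) = (G_L − x)² − (a − G_L)(b − G_L) = −c²·det[Π(gL,g0) Π(gL,g3); Π(gR,g0) Π(gR,g3)]`: S3' is a
second-order cancellation in the cross-Gram matrix of `{gL, gR}` against `{g 0, g 3}` (helper IV makes this the reduction).
Fixed-`N` statements; standard axioms; no definitions; nothing taken as a named fact.
-/
noncomputable section

open MeasureTheory Filter Topology
open scoped ContDiff
open Literature.MathematicalPhysics.KineticTheory.HeatConduction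
open Summit.AtomisticToContinuum.FouriersLaw.Theorems.SuperadditiveResistance.DeviceLiouville
  (kin deviceGenerator deviceWeight deviceGenerator_eq kin_eq_sq liouvilleOp bathOp generator_eq_liouvilleOp_add)
open Summit.AtomisticToContinuum.FouriersLaw.Theorems.SuperadditiveResistance.Kubo
  (rev rev_apply contDiff_rev continuous_rev memLp_rev rev_pair partialP_rev_eq cross_level chi contDiff_chi
    hasCompactSupport_chi memLp_partialP integrable_mul_mul_gibbsDensity integral_rev_mul_gibbsDensity
    tendsto_integral_chi_mul tendsto_integral_partialP_chi_mul integral_chi_mul_bathOp continuous_source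
    continuous_bathOp tendsto_sum_mul)
open Summit.AtomisticToContinuum.FouriersLaw.Cruxes.ConductanceLowerBound.ForecastSensitivity
  (measurePreserving_siteReflection_gibbsMeasure kin_zero_siteReflection)
open Summit.AtomisticToContinuum.FouriersLaw.Cruxes.SuperadditiveResistance.ThermaliseThenCutProbeInsertion
  (plainField_endPairing)

namespace Summit.AtomisticToContinuum.FouriersLaw.Cruxes.SuperadditiveResistance.FloatingProbeBypassLaplacian

/-! ## §1 The master pairing: a plain pair against a device resolvent field -/

section Master

variable {ω₂ lam β γ T : ℝ} {N M : ℕ}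

/-- **The cutoff junction pairings of a plain pair against a device resolvent field converge (no regularity
hypothesis; fixed `N`, `M ≥ 1`, `κ`).** For `h ∈ C² ∩ L²(μ_T)` with `L^{T,T} h = −(kin t − T)` and a `κ`-resolvent
field `g` of the device for site `s`:
`γT Σ_{s'∈{N−1,N}} ∫ χ_n ∂_{p_{s'}} g ∂_{p_{s'}}(h∘R) ρ ⟶ ∫ h (kin s − T) ρ − κ ∫ (h∘R) g ρ − ∫ g (kin t − T) ρ`. -/
theorem tendsto_plainPair_resolvent_pairing (hω : 0 < ω₂) (hl : 0 ≤ lam) (hβ : 0 ≤ β) (hγ : 0 < γ) (hT : 0 < T)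
    (hM : 1 ≤ M) {κ : ℝ} {s : ℕ} (t : ℕ) {g : PhaseSpace (N + M) → ℝ}
    (hg : g ∈ deviceResolventFields ω₂ lam β γ T N M s κ) {h : PhaseSpace (N + M) → ℝ} (hhC : ContDiff ℝ 2 h)
    (hhL : MemLp h 2 ((pinnedChain ω₂ lam β γ).gibbsMeasure (N + M) T))
    (hpdeh : ∀ x, (pinnedChain ω₂ lam β γ).generator (N + M) T T h x = -(kin (N + M) t x - T)) :
    Tendsto (fun n : ℕ => γ * T *
      ((∫ x, chi (pinnedChain ω₂ lam β γ) (N + M) n x * (partialP ⟨N - 1, by omega⟩ g x *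
          partialP ⟨N - 1, by omega⟩ (rev h) x) * (pinnedChain ω₂ lam β γ).gibbsDensity (N + M) T x) +
        ∫ x, chi (pinnedChain ω₂ lam β γ) (N + M) n x * (partialP ⟨N, by omega⟩ g x *
          partialP ⟨N, by omega⟩ (rev h) x) * (pinnedChain ω₂ lam β γ).gibbsDensity (N + M) T x)) atTop
      (𝓝 ((∫ x, h x * (kin (N + M) s x - T) * (pinnedChain ω₂ lam β γ).gibbsDensity (N + M) T x) -
        κ * (∫ x, h (x.1, -x.2) * g x * (pinnedChain ω₂ lam β γ).gibbsDensity (N + M) T x) -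
        ∫ x, g x * (kin (N + M) t x - T) * (pinnedChain ω₂ lam β γ).gibbsDensity (N + M) T x)) := by
  obtain ⟨hgC, hgL, hpde⟩ := hg
  set P := pinnedChain ω₂ lam β γ with hP
  set μ := P.gibbsMeasure (N + M) T with hμ
  set ρ : PhaseSpace (N + M) → ℝ := P.gibbsDensity (N + M) T with hρ
  have hrevC : ContDiff ℝ 2 (rev h) := contDiff_rev hhC
  have hrevL : MemLp (rev h) 2 μ := memLp_rev hω hl hβ (N + M) hT hhC.continuous hhL
  have hkf : MemLp (fun x : PhaseSpace (N + M) => (kin (N + M) s x - T) - κ * g x) 2 μ :=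
    (memLp_kin_sub hω hl hβ γ (N + M) s hT).sub (hgL.const_mul κ)
  have hkh : MemLp (fun x : PhaseSpace (N + M) => kin (N + M) t x - T) 2 μ := memLp_kin_sub hω hl hβ γ (N + M) t hT
  have hlim := tendsto_cross_addWeights hω hl hβ (N + M) hT (OscillatorChain.bathWeight (N + M))
    (fun i : Fin (N + M) => (if i.val = N - 1 then (1 : ℝ) else 0) + (if i.val = N then (1 : ℝ) else 0))
    (bathWeight_nonneg (N + M)) (probeWeight_nonneg N M) 1 hγ hgC hrevC hgL hrevL hkf hkh
    (deviceResolvent_pair_add κ s hpde) (plainPair_rev_pair ω₂ lam β γ T t hpdeh)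
  rw [← hP] at hlim
  rw [← hρ] at hlim
  simp only [sum_probeWeight_mul hM] at hlim
  rw [integral_rev_mul_resolventSource hω hl hβ hT κ s hgL hhC.continuous hhL] at hlim
  exact hlim

/-- **THE MASTER PAIRING (fixed `N`, `M ≥ 1`, `κ`; junction-gradient regularity as explicit hypotheses).** For the pinned
chain (`ω₂ > 0`, `lam, β ≥ 0`, `γ, T > 0`), a classical `h ∈ C² ∩ L²(μ_T)` with `L^{T,T}_{N+M} h = −(kin t − T)` whose
JUNCTION momentum gradients `∂_{p_{N−1}} h, ∂_{p_N} h` are in `L²(μ_T)`, and a `κ`-resolvent field `g` of the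
`(N, M)`-device for site `s` (`κ g − L_dev g = kin s − T`, `g ∈ C² ∩ L²(μ_T)`):

  `⟨h, kin s − T⟩ − ⟨g, kin t − T⟩ = κ ⟨h∘R, g⟩ + γT (⟨∂_{p_{N−1}}(h∘R), ∂_{p_{N−1}} g⟩ + ⟨∂_{p_N}(h∘R), ∂_{p_N} g⟩)`

(all pairings in `L²(μ_T^{(N+M)})`, `R` the momentum reversal): Green's cross identity for the two thermostat sets
`B_dev = B_plain + W_K` (`cross_addWeights`) for the forward pair `g` against the backward pair `h∘R`, reversal
invariance of `μ_T`; the device field's probe gradients are in `L²` because the probes ARE thermostats of the device. -/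
theorem plainPair_resolvent_pairing (hω : 0 < ω₂) (hl : 0 ≤ lam) (hβ : 0 ≤ β) (hγ : 0 < γ) (hT : 0 < T)
    (hM : 1 ≤ M) {κ : ℝ} {s : ℕ} (t : ℕ) {g : PhaseSpace (N + M) → ℝ}
    (hg : g ∈ deviceResolventFields ω₂ lam β γ T N M s κ) {h : PhaseSpace (N + M) → ℝ} (hhC : ContDiff ℝ 2 h)
    (hhL : MemLp h 2 ((pinnedChain ω₂ lam β γ).gibbsMeasure (N + M) T))
    (hpdeh : ∀ x, (pinnedChain ω₂ lam β γ).generator (N + M) T T h x = -(kin (N + M) t x - T))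
    (hreg₁ : MemLp (partialP ⟨N - 1, by omega⟩ h) 2 ((pinnedChain ω₂ lam β γ).gibbsMeasure (N + M) T))
    (hreg₂ : MemLp (partialP ⟨N, by omega⟩ h) 2 ((pinnedChain ω₂ lam β γ).gibbsMeasure (N + M) T)) :
    (∫ x, h x * (kin (N + M) s x - T) ∂((pinnedChain ω₂ lam β γ).gibbsMeasure (N + M) T)) -
        ∫ x, g x * (kin (N + M) t x - T) ∂((pinnedChain ω₂ lam β γ).gibbsMeasure (N + M) T) =
      κ * ∫ x, h (x.1, -x.2) * g x ∂((pinnedChain ω₂ lam β γ).gibbsMeasure (N + M) T) +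
        γ * T * ((∫ x, partialP ⟨N - 1, by omega⟩ (rev h) x * partialP ⟨N - 1, by omega⟩ g x
            ∂((pinnedChain ω₂ lam β γ).gibbsMeasure (N + M) T)) +
          ∫ x, partialP ⟨N, by omega⟩ (rev h) x * partialP ⟨N, by omega⟩ g x
            ∂((pinnedChain ω₂ lam β γ).gibbsMeasure (N + M) T)) := by
  obtain ⟨hgC, hgL, hpde⟩ := hg
  set P := pinnedChain ω₂ lam β γ with hP
  set μ := P.gibbsMeasure (N + M) T with hμ
  set ρ : PhaseSpace (N + M) → ℝ := P.gibbsDensity (N + M) T with hρ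
  have hrevC : ContDiff ℝ 2 (rev h) := contDiff_rev hhC
  have hrevL : MemLp (rev h) 2 μ := memLp_rev hω hl hβ (N + M) hT hhC.continuous hhL
  have hkf : MemLp (fun x : PhaseSpace (N + M) => (kin (N + M) s x - T) - κ * g x) 2 μ :=
    (memLp_kin_sub hω hl hβ γ (N + M) s hT).sub (hgL.const_mul κ)
  have hkh : MemLp (fun x : PhaseSpace (N + M) => kin (N + M) t x - T) 2 μ := memLp_kin_sub hω hl hβ γ (N + M) t hT
  -- junction regularity of `h∘R`
  have hWh : ∀ i : Fin (N + M), (if i.val = N - 1 then (1 : ℝ) else 0) + (if i.val = N then (1 : ℝ) else 0) ≠ 0 →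
      MemLp (partialP i (rev h)) 2 μ := by
    intro i hi
    have key : ∀ j : Fin (N + M), MemLp (partialP j h) 2 μ → MemLp (partialP j (rev h)) 2 μ := by
      intro j hj
      rw [partialP_rev_eq]
      exact (memLp_rev hω hl hβ (N + M) hT (continuous_partialP hhC two_ne_zero j) hj).neg
    rcases eq_of_probeWeight_ne_zero hM hi with h1 | h2
    · subst h1; exact key _ hreg₁
    · subst h2; exact key _ hreg₂
  have hX := cross_addWeights hω hl hβ (N + M) hT (OscillatorChain.bathWeight (N + M))
    (fun i : Fin (N + M) => (if i.val = N - 1 then (1 : ℝ) else 0) + (if i.val = N then (1 : ℝ) else 0))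
    (bathWeight_nonneg (N + M)) (probeWeight_nonneg N M) 1 hγ hgC hrevC hgL hrevL hkf hkh
    (deviceResolvent_pair_add κ s hpde) (plainPair_rev_pair ω₂ lam β γ T t hpdeh) hWh
  rw [← hP] at hX
  rw [← hρ] at hX
  simp only [sum_probeWeight_mul hM] at hX
  rw [integral_rev_mul_resolventSource hω hl hβ hT κ s hgL hhC.continuous hhL] at hX
  rw [← hP] at hX
  rw [← hρ] at hX
  -- reorder the Dirichlet integrands and pass to the Gibbs MEASURE
  have e1 : ∫ x, partialP ⟨N - 1, by omega⟩ g x * partialP ⟨N - 1, by omega⟩ (rev h) x * ρ x =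
      ∫ x, partialP ⟨N - 1, by omega⟩ (rev h) x * partialP ⟨N - 1, by omega⟩ g x * ρ x :=
    integral_congr_ae (ae_of_all _ fun x => by ring)
  have e2 : ∫ x, partialP ⟨N, by omega⟩ g x * partialP ⟨N, by omega⟩ (rev h) x * ρ x =
      ∫ x, partialP ⟨N, by omega⟩ (rev h) x * partialP ⟨N, by omega⟩ g x * ρ x :=
    integral_congr_ae (ae_of_all _ fun x => by ring)
  rw [e1, e2] at hX
  rw [P.integral_gibbsMeasure, P.integral_gibbsMeasure, P.integral_gibbsMeasure, P.integral_gibbsMeasure,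
    P.integral_gibbsMeasure]
  rw [← hρ]
  linear_combination (∫ x, ρ x)⁻¹ * hX

end Master

/-! ## §2 The four κ-frame probe-removal identities -/

section Identities

variable {ω₂ lam β γ T : ℝ} {N M : ℕ}

/-- `K₃₃ = γ − (γ²/T²)⟨g_3, kin(N+M−1) − T⟩` (unfolding the skeleton's `kuboMatrix` at `(3, 3)`). -/
theorem kuboMatrix_three_three_eq (ω₂ lam β γ T : ℝ) (N M : ℕ) (g : Fin 4 → PhaseSpace (N + M) → ℝ) :
    kuboMatrix ω₂ lam β γ T N M g 3 3 = γ - γ ^ 2 / T ^ 2 *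
      ∫ x, g 3 x * (kin (N + M) (N + M - 1) x - T) ∂((pinnedChain ω₂ lam β γ).gibbsMeasure (N + M) T) := by
  simp [kuboMatrix, termSite_three]

/-- **(I0) THE κ-FRAME PROBE-REMOVAL IDENTITY FOR `a − G_L` (fixed `N`, `M ≥ 1`, `κ`).** For the pinned chain
(`ω₂ > 0`, `lam, β ≥ 0`, `γ, T > 0`), a `κ`-resolvent field `g 0` of bath `0` of the `(N, M)`-device and a plain forward
field `gL` of the WHOLE `(N+M)`-chain whose junction momentum gradients `∂_{p_{N−1}} gL, ∂_{p_N} gL` are in `L²(μ_T)`: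

  `K₀₀(κ) − G_L = (γ²/T²)·(κ⟨gL∘R, g 0⟩ + γT(⟨∂_{p_{N−1}}(gL∘R), ∂_{p_{N−1}}(g 0)⟩ + ⟨∂_{p_N}(gL∘R), ∂_{p_N}(g 0)⟩))`.

For a member of the skeleton's resolvent family use `hg 0`. -/
theorem kuboMatrix_zero_zero_sub_plainKubo_dirichlet (hω : 0 < ω₂) (hl : 0 ≤ lam) (hβ : 0 ≤ β) (hγ : 0 < γ)
    (hT : 0 < T) (hM : 1 ≤ M) (κ : ℝ) (g : Fin 4 → PhaseSpace (N + M) → ℝ) (gL : PhaseSpace (N + M) → ℝ)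
    (hg₀ : g 0 ∈ deviceResolventFields ω₂ lam β γ T N M 0 κ) (hgL : gL ∈ plainForwardFields ω₂ lam β γ T (N + M))
    (hreg₁ : MemLp (partialP ⟨N - 1, by omega⟩ gL) 2 ((pinnedChain ω₂ lam β γ).gibbsMeasure (N + M) T))
    (hreg₂ : MemLp (partialP ⟨N, by omega⟩ gL) 2 ((pinnedChain ω₂ lam β γ).gibbsMeasure (N + M) T)) :
    kuboMatrix ω₂ lam β γ T N M g 0 0 - plainKubo ω₂ lam β γ T (N + M) gL =
      γ ^ 2 / T ^ 2 * (κ * ∫ x, gL (x.1, -x.2) * g 0 x ∂((pinnedChain ω₂ lam β γ).gibbsMeasure (N + M) T) +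
        γ * T * ((∫ x, partialP ⟨N - 1, by omega⟩ (rev gL) x * partialP ⟨N - 1, by omega⟩ (g 0) x
            ∂((pinnedChain ω₂ lam β γ).gibbsMeasure (N + M) T)) +
          ∫ x, partialP ⟨N, by omega⟩ (rev gL) x * partialP ⟨N, by omega⟩ (g 0) x
            ∂((pinnedChain ω₂ lam β γ).gibbsMeasure (N + M) T))) := by
  obtain ⟨hgLC, hgLL, -, hpdeL⟩ := hgL
  have hD := plainPair_resolvent_pairing hω hl hβ hγ hT hM 0 hg₀ hgLC hgLL hpdeL hreg₁ hreg₂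
  rw [kuboMatrix_zero_zero_eq, plainKubo]
  linear_combination (γ ^ 2 / T ^ 2) * hD

/-- **(I3) THE κ-FRAME PROBE-REMOVAL IDENTITY FOR `G_L + K₃₀ = G_L − x` (fixed `N ≥ 1`, `M ≥ 1`, `κ`; `β > 0`).** Same
setting, with the `κ`-resolvent field `g 3` of the FAR bath `N+M−1`:

  `G_L + K₃₀(κ) = (γ²/T²)·(κ⟨gL∘R, g 3⟩ + γT(⟨∂_{p_{N−1}}(gL∘R), ∂_{p_{N−1}}(g 3)⟩ + ⟨∂_{p_N}(gL∘R), ∂_{p_N}(g 3)⟩))`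

(the master pairing plus the far-end sum rule `⟨gL, p²_{N+M−1} − T⟩ = T²/γ − ⟨gL, p_0² − T⟩`, landed
`plainField_endPairing`). With the Onsager symmetry `K₃₀ = K₀₃` of resolvent families this is `G_L − x`. -/
theorem plainKubo_add_kuboMatrix_three_zero_dirichlet (hω : 0 < ω₂) (hl : 0 ≤ lam) (hβ : 0 < β) (hγ : 0 < γ)
    (hT : 0 < T) (hN : 1 ≤ N) (hM : 1 ≤ M) (κ : ℝ) (g : Fin 4 → PhaseSpace (N + M) → ℝ)
    (gL : PhaseSpace (N + M) → ℝ) (hg₃ : g 3 ∈ deviceResolventFields ω₂ lam β γ T N M (N + M - 1) κ)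
    (hgL : gL ∈ plainForwardFields ω₂ lam β γ T (N + M))
    (hreg₁ : MemLp (partialP ⟨N - 1, by omega⟩ gL) 2 ((pinnedChain ω₂ lam β γ).gibbsMeasure (N + M) T))
    (hreg₂ : MemLp (partialP ⟨N, by omega⟩ gL) 2 ((pinnedChain ω₂ lam β γ).gibbsMeasure (N + M) T)) :
    plainKubo ω₂ lam β γ T (N + M) gL + kuboMatrix ω₂ lam β γ T N M g 3 0 =
      γ ^ 2 / T ^ 2 * (κ * ∫ x, gL (x.1, -x.2) * g 3 x ∂((pinnedChain ω₂ lam β γ).gibbsMeasure (N + M) T) +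
        γ * T * ((∫ x, partialP ⟨N - 1, by omega⟩ (rev gL) x * partialP ⟨N - 1, by omega⟩ (g 3) x
            ∂((pinnedChain ω₂ lam β γ).gibbsMeasure (N + M) T)) +
          ∫ x, partialP ⟨N, by omega⟩ (rev gL) x * partialP ⟨N, by omega⟩ (g 3) x
            ∂((pinnedChain ω₂ lam β γ).gibbsMeasure (N + M) T))) := by
  obtain ⟨hgLC, hgLL, -, hpdeL⟩ := hgL
  have hD := plainPair_resolvent_pairing hω hl hβ.le hγ hT hM 0 hg₃ hgLC hgLL hpdeL hreg₁ hreg₂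
  have hend : ∫ x, gL x * (kin (N + M) (N + M - 1) x - T) ∂((pinnedChain ω₂ lam β γ).gibbsMeasure (N + M) T) =
      T ^ 2 / γ - ∫ x, gL x * (kin (N + M) 0 x - T) ∂((pinnedChain ω₂ lam β γ).gibbsMeasure (N + M) T) :=
    plainField_endPairing hω hl hβ hγ (show 1 ≤ N + M by omega) hT hgLC hgLL hpdeL
  rw [hend] at hD
  rw [kuboMatrix_three_zero_eq, plainKubo]
  have hkey : γ ^ 2 / T ^ 2 * (T ^ 2 / γ) = γ := by
    rw [div_mul_div_comm, div_eq_iff (by positivity)]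
    ring
  linear_combination (γ ^ 2 / T ^ 2) * hD - hkey

/-- **Regularity transport under the site reflection.** If `∂_{p_{rev i}} gL ∈ L²(μ_T)` then
`∂_{p_i}(gL ∘ siteReflection) ∈ L²(μ_T)` (chain rule `partialP_comp_siteReflection` and reflection invariance of `μ_T`). -/
theorem memLp_partialP_comp_siteReflection {L : ℕ} {gL : PhaseSpace L → ℝ} (i : Fin L)
    (h : MemLp (partialP (Fin.rev i) gL) 2 ((pinnedChain ω₂ lam β γ).gibbsMeasure L T)) :
    MemLp (partialP i (gL ∘ siteReflection L)) 2 ((pinnedChain ω₂ lam β γ).gibbsMeasure L T) := by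
  have e : partialP i (gL ∘ siteReflection L) = partialP (Fin.rev i) gL ∘ siteReflection L :=
    funext fun x => partialP_comp_siteReflection i gL x
  rw [e]
  exact h.comp_measurePreserving
    (measurePreserving_siteReflection_gibbsMeasure _ (pinnedChain_V_neg ω₂ lam β γ) L T)

/-- The reflected plain field pairs with the far kinetic observable as the plain field pairs with the near one:
`⟨gL∘S, kin(L−1) − T⟩ = ⟨gL, kin 0 − T⟩` (`S` the site reflection; `μ_T` is `S`-invariant). -/
theorem integral_comp_siteReflection_mul_kin_last {L : ℕ} (hL : 0 < L) (gL : PhaseSpace L → ℝ) :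
    ∫ x, gL (siteReflection L x) * (kin L (L - 1) x - T) ∂((pinnedChain ω₂ lam β γ).gibbsMeasure L T) =
      ∫ x, gL x * (kin L 0 x - T) ∂((pinnedChain ω₂ lam β γ).gibbsMeasure L T) := by
  have hR := measurePreserving_siteReflection_gibbsMeasure (pinnedChain ω₂ lam β γ) (pinnedChain_V_neg ω₂ lam β γ) L T
  have h := hR.integral_comp' (f := siteReflectionEquiv L) (fun y => gL y * (kin L 0 y - T))
  simp only [siteReflectionEquiv_apply, kin_zero_siteReflection hL] at h
  exact h

/-- Dually `⟨gL∘S, kin 0 − T⟩ = ⟨gL, kin(L−1) − T⟩`. -/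
theorem integral_comp_siteReflection_mul_kin_zero {L : ℕ} (hL : 0 < L) (gL : PhaseSpace L → ℝ) :
    ∫ x, gL (siteReflection L x) * (kin L 0 x - T) ∂((pinnedChain ω₂ lam β γ).gibbsMeasure L T) =
      ∫ x, gL x * (kin L (L - 1) x - T) ∂((pinnedChain ω₂ lam β γ).gibbsMeasure L T) := by
  have hR := measurePreserving_siteReflection_gibbsMeasure (pinnedChain ω₂ lam β γ) (pinnedChain_V_neg ω₂ lam β γ) L T
  have h := hR.integral_comp' (f := siteReflectionEquiv L) (fun y => gL y * (kin L (L - 1) y - T))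
  have e : ∀ x : PhaseSpace L, kin L (L - 1) (siteReflection L x) = kin L 0 x := fun x => by
    rw [← kin_zero_siteReflection hL (siteReflection L x), siteReflection_siteReflection]
  simp only [siteReflectionEquiv_apply, e] at h
  exact h

/-- **(I3') THE κ-FRAME PROBE-REMOVAL IDENTITY FOR `b − G_L` (fixed `N ≥ 1`, `M ≥ 1`, `κ`).** With the RIGHT bath's
forward field `gR := gL ∘ siteReflection` of the whole chain (landed `generator_comp_siteReflection_left`) and the
`κ`-resolvent field `g 3` of the far bath; the junction gradients of `gR` are the MIRRORED junction gradients
`∂_{p_{M−1}} gL, ∂_{p_M} gL` of `gL`, assumed in `L²(μ_T)`: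

  `K₃₃(κ) − G_L = (γ²/T²)·(κ⟨gR∘R, g 3⟩ + γT(⟨∂_{p_{N−1}}(gR∘R), ∂_{p_{N−1}}(g 3)⟩ + ⟨∂_{p_N}(gR∘R), ∂_{p_N}(g 3)⟩))`

(`G_L` is read off `gL`; `⟨gR, p²_{N+M−1} − T⟩ = ⟨gL, p_0² − T⟩` by reflection invariance of `μ_T`). -/
theorem kuboMatrix_three_three_sub_plainKubo_dirichlet (hω : 0 < ω₂) (hl : 0 ≤ lam) (hβ : 0 ≤ β) (hγ : 0 < γ)
    (hT : 0 < T) (hN : 1 ≤ N) (hM : 1 ≤ M) (κ : ℝ) (g : Fin 4 → PhaseSpace (N + M) → ℝ)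
    (gL : PhaseSpace (N + M) → ℝ) (hg₃ : g 3 ∈ deviceResolventFields ω₂ lam β γ T N M (N + M - 1) κ)
    (hgL : gL ∈ plainForwardFields ω₂ lam β γ T (N + M))
    (hreg₁ : MemLp (partialP ⟨M - 1, by omega⟩ gL) 2 ((pinnedChain ω₂ lam β γ).gibbsMeasure (N + M) T))
    (hreg₂ : MemLp (partialP ⟨M, by omega⟩ gL) 2 ((pinnedChain ω₂ lam β γ).gibbsMeasure (N + M) T)) :
    kuboMatrix ω₂ lam β γ T N M g 3 3 - plainKubo ω₂ lam β γ T (N + M) gL =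
      γ ^ 2 / T ^ 2 * (κ * ∫ x, (gL ∘ siteReflection (N + M)) (x.1, -x.2) * g 3 x
          ∂((pinnedChain ω₂ lam β γ).gibbsMeasure (N + M) T) +
        γ * T * ((∫ x, partialP ⟨N - 1, by omega⟩ (rev (gL ∘ siteReflection (N + M))) x *
            partialP ⟨N - 1, by omega⟩ (g 3) x ∂((pinnedChain ω₂ lam β γ).gibbsMeasure (N + M) T)) +
          ∫ x, partialP ⟨N, by omega⟩ (rev (gL ∘ siteReflection (N + M))) x * partialP ⟨N, by omega⟩ (g 3) x
            ∂((pinnedChain ω₂ lam β γ).gibbsMeasure (N + M) T))) := by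
  obtain ⟨hgLC, hgLL, -, hpdeL⟩ := hgL
  set gR : PhaseSpace (N + M) → ℝ := gL ∘ siteReflection (N + M) with hgR
  have hgRC : ContDiff ℝ 2 gR := hgLC.comp contDiff_siteReflection
  have hgRL : MemLp gR 2 ((pinnedChain ω₂ lam β γ).gibbsMeasure (N + M) T) :=
    Theorems.SuperadditiveResistance.KuboPlain.memLp_comp_siteReflection hω hl hβ hT hgLC.continuous hgLL
  have hpdeR : ∀ x, (pinnedChain ω₂ lam β γ).generator (N + M) T T gR x = -(kin (N + M) (N + M - 1) x - T) :=
    fun x => Theorems.SuperadditiveResistance.KuboPlain.generator_comp_siteReflection_left ω₂ lam β γ T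
      (show 1 ≤ N + M by omega) hpdeL x
  have hrev₁ : Fin.rev (⟨N - 1, by omega⟩ : Fin (N + M)) = ⟨M, by omega⟩ :=
    Fin.ext (by simp only [Fin.val_rev]; omega)
  have hrev₂ : Fin.rev (⟨N, by omega⟩ : Fin (N + M)) = ⟨M - 1, by omega⟩ :=
    Fin.ext (by simp only [Fin.val_rev]; omega)
  have hregR₁ : MemLp (partialP ⟨N - 1, by omega⟩ gR) 2 ((pinnedChain ω₂ lam β γ).gibbsMeasure (N + M) T) :=
    memLp_partialP_comp_siteReflection _ (by rw [hrev₁]; exact hreg₂)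
  have hregR₂ : MemLp (partialP ⟨N, by omega⟩ gR) 2 ((pinnedChain ω₂ lam β γ).gibbsMeasure (N + M) T) :=
    memLp_partialP_comp_siteReflection _ (by rw [hrev₂]; exact hreg₁)
  have hD := plainPair_resolvent_pairing hω hl hβ hγ hT hM (N + M - 1) hg₃ hgRC hgRL hpdeR hregR₁ hregR₂
  have hrefl : ∫ x, gR x * (kin (N + M) (N + M - 1) x - T) ∂((pinnedChain ω₂ lam β γ).gibbsMeasure (N + M) T) =
      ∫ x, gL x * (kin (N + M) 0 x - T) ∂((pinnedChain ω₂ lam β γ).gibbsMeasure (N + M) T) :=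
    integral_comp_siteReflection_mul_kin_last (show 0 < N + M by omega) gL
  rw [hrefl] at hD
  rw [kuboMatrix_three_three_eq, plainKubo]
  linear_combination (γ ^ 2 / T ^ 2) * hD

/-- **(I0') THE κ-FRAME PROBE-REMOVAL IDENTITY FOR `G_L + K₀₃ = G_L − x` (fixed `N ≥ 1`, `M ≥ 1`, `κ`; `β > 0`).**
With `gR := gL ∘ siteReflection` and the `κ`-resolvent field `g 0` of bath `0`:

  `G_L + K₀₃(κ) = (γ²/T²)·(κ⟨gR∘R, g 0⟩ + γT(⟨∂_{p_{N−1}}(gR∘R), ∂_{p_{N−1}}(g 0)⟩ + ⟨∂_{p_N}(gR∘R), ∂_{p_N}(g 0)⟩))`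

(reflection invariance `⟨gR, p_0² − T⟩ = ⟨gL, p²_{N+M−1} − T⟩` and the far-end sum rule). -/
theorem plainKubo_add_kuboMatrix_zero_three_dirichlet (hω : 0 < ω₂) (hl : 0 ≤ lam) (hβ : 0 < β) (hγ : 0 < γ)
    (hT : 0 < T) (hN : 1 ≤ N) (hM : 1 ≤ M) (κ : ℝ) (g : Fin 4 → PhaseSpace (N + M) → ℝ)
    (gL : PhaseSpace (N + M) → ℝ) (hg₀ : g 0 ∈ deviceResolventFields ω₂ lam β γ T N M 0 κ)
    (hgL : gL ∈ plainForwardFields ω₂ lam β γ T (N + M))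
    (hreg₁ : MemLp (partialP ⟨M - 1, by omega⟩ gL) 2 ((pinnedChain ω₂ lam β γ).gibbsMeasure (N + M) T))
    (hreg₂ : MemLp (partialP ⟨M, by omega⟩ gL) 2 ((pinnedChain ω₂ lam β γ).gibbsMeasure (N + M) T)) :
    plainKubo ω₂ lam β γ T (N + M) gL + kuboMatrix ω₂ lam β γ T N M g 0 3 =
      γ ^ 2 / T ^ 2 * (κ * ∫ x, (gL ∘ siteReflection (N + M)) (x.1, -x.2) * g 0 x
          ∂((pinnedChain ω₂ lam β γ).gibbsMeasure (N + M) T) +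
        γ * T * ((∫ x, partialP ⟨N - 1, by omega⟩ (rev (gL ∘ siteReflection (N + M))) x *
            partialP ⟨N - 1, by omega⟩ (g 0) x ∂((pinnedChain ω₂ lam β γ).gibbsMeasure (N + M) T)) +
          ∫ x, partialP ⟨N, by omega⟩ (rev (gL ∘ siteReflection (N + M))) x * partialP ⟨N, by omega⟩ (g 0) x
            ∂((pinnedChain ω₂ lam β γ).gibbsMeasure (N + M) T))) := by
  obtain ⟨hgLC, hgLL, -, hpdeL⟩ := hgL
  set gR : PhaseSpace (N + M) → ℝ := gL ∘ siteReflection (N + M) with hgR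
  have hgRC : ContDiff ℝ 2 gR := hgLC.comp contDiff_siteReflection
  have hgRL : MemLp gR 2 ((pinnedChain ω₂ lam β γ).gibbsMeasure (N + M) T) :=
    Theorems.SuperadditiveResistance.KuboPlain.memLp_comp_siteReflection hω hl hβ.le hT hgLC.continuous hgLL
  have hpdeR : ∀ x, (pinnedChain ω₂ lam β γ).generator (N + M) T T gR x = -(kin (N + M) (N + M - 1) x - T) :=
    fun x => Theorems.SuperadditiveResistance.KuboPlain.generator_comp_siteReflection_left ω₂ lam β γ T
      (show 1 ≤ N + M by omega) hpdeL x
  have hrev₁ : Fin.rev (⟨N - 1, by omega⟩ : Fin (N + M)) = ⟨M, by omega⟩ :=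
    Fin.ext (by simp only [Fin.val_rev]; omega)
  have hrev₂ : Fin.rev (⟨N, by omega⟩ : Fin (N + M)) = ⟨M - 1, by omega⟩ :=
    Fin.ext (by simp only [Fin.val_rev]; omega)
  have hregR₁ : MemLp (partialP ⟨N - 1, by omega⟩ gR) 2 ((pinnedChain ω₂ lam β γ).gibbsMeasure (N + M) T) :=
    memLp_partialP_comp_siteReflection _ (by rw [hrev₁]; exact hreg₂)
  have hregR₂ : MemLp (partialP ⟨N, by omega⟩ gR) 2 ((pinnedChain ω₂ lam β γ).gibbsMeasure (N + M) T) :=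
    memLp_partialP_comp_siteReflection _ (by rw [hrev₂]; exact hreg₁)
  have hD := plainPair_resolvent_pairing hω hl hβ.le hγ hT hM (N + M - 1) hg₀ hgRC hgRL hpdeR hregR₁ hregR₂
  have hrefl : ∫ x, gR x * (kin (N + M) 0 x - T) ∂((pinnedChain ω₂ lam β γ).gibbsMeasure (N + M) T) =
      ∫ x, gL x * (kin (N + M) (N + M - 1) x - T) ∂((pinnedChain ω₂ lam β γ).gibbsMeasure (N + M) T) :=
    integral_comp_siteReflection_mul_kin_zero (show 0 < N + M by omega) gL
  have hend : ∫ x, gL x * (kin (N + M) (N + M - 1) x - T) ∂((pinnedChain ω₂ lam β γ).gibbsMeasure (N + M) T) =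
      T ^ 2 / γ - ∫ x, gL x * (kin (N + M) 0 x - T) ∂((pinnedChain ω₂ lam β γ).gibbsMeasure (N + M) T) :=
    plainField_endPairing hω hl hβ hγ (show 1 ≤ N + M by omega) hT hgLC hgLL hpdeL
  rw [hrefl, hend] at hD
  rw [kuboMatrix_zero_three_eq, plainKubo]
  have hkey : γ ^ 2 / T ^ 2 * (T ^ 2 / γ) = γ := by
    rw [div_mul_div_comm, div_eq_iff (by positivity)]
    ring
  linear_combination (γ ^ 2 / T ^ 2) * hD - hkey

end Identities

/-- Registered helper sub-goal `helper_probeRemovalDirichletIdentity` (= `kuboMatrix_zero_zero_sub_plainKubo_dirichlet` (I0) with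
every binder explicit and `h∘R` written as a lambda): the κ-frame probe-removal identity for `K₀₀ − G_L` in Dirichlet form. -/
theorem helper_probeRemovalDirichletIdentity : ∀ {ω₂ lam β γ T : ℝ} {N M : ℕ}, 0 < ω₂ → 0 ≤ lam → 0 ≤ β → 0 < γ → 0 < T → ∀ (hM : 1 ≤ M) (κ : ℝ) (g : Fin 4 → PhaseSpace (N + M) → ℝ) (gL : PhaseSpace (N + M) → ℝ), g 0 ∈ deviceResolventFields ω₂ lam β γ T N M 0 κ → gL ∈ plainForwardFields ω₂ lam β γ T (N + M) → MemLp (partialP ⟨N - 1, by omega⟩ gL) 2 ((pinnedChain ω₂ lam β γ).gibbsMeasure (N + M) T) → MemLp (partialP ⟨N, by omega⟩ gL) 2 ((pinnedChain ω₂ lam β γ).gibbsMeasure (N + M) T) → kuboMatrix ω₂ lam β γ T N M g 0 0 - plainKubo ω₂ lam β γ T (N + M) gL = γ ^ 2 / T ^ 2 * (κ * ∫ x, gL (x.1, -x.2) * g 0 x ∂((pinnedChain ω₂ lam β γ).gibbsMeasure (N + M) T) + γ * T * ((∫ x, partialP ⟨N - 1, by omega⟩ (fun y : PhaseSpace (N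 + M) => gL (y.1, -y.2)) x * partialP ⟨N - 1, by omega⟩ (g 0) x ∂((pinnedChain ω₂ lam β γ).gibbsMeasure (N + M) T)) + ∫ x, partialP ⟨N, by omega⟩ (fun y : PhaseSpace (N + M) => gL (y.1, -y.2)) x * partialP ⟨N, by omega⟩ (g 0) x ∂((pinnedChain ω₂ lam β γ).gibbsMeasure (N + M) T))) :=
  fun hω hl hβ hγ hT hM κ g gL hg₀ hgL hreg₁ hreg₂ =>
    kuboMatrix_zero_zero_sub_plainKubo_dirichlet hω hl hβ hγ hT hM κ g gL hg₀ hgL hreg₁ hreg₂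

end Summit.AtomisticToContinuum.FouriersLaw.Cruxes.SuperadditiveResistance.FloatingProbeBypassLaplacian

end
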